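import Mathlib
import HarnessLib
import Literature.Analysis.Calculus.IteratedFDerivSymmetric
import Summits.NavierStokesRegularity.NavierStokesRegularity.Theorems.PoloidalWindowDoorLrcModEntireCurvedWebHuygens

/-!
# Route `PoloidalWindowDoor`, item `LrcModEntire` (stmt-NavierStokesRegularity-20428), cell (Q4-curved) of the (TH) column —
# CAUCHY–KOVALEVSKAYA UNIQUENESS ACROSS A CURVED NON-CHARACTERISTIC WEB SHEET (frame-free jet induction)

Cell ns-regularity-ideate, stub-worker seat ns-poloidal-K2-p2 g16 under the LEAD of item 20428 (ns-poloidal-K2-p3 g17);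
`--supports stmt-NavierStokesRegularity-20428 --as helper`.  Memo `Cruxes/LrcModEntire/T2B-g16.md` §3 («PERIODIC base curve … the same recursion in the Fermi
coordinates») / §6 (the missing brick of the periodic sub-case of `stub_Q4curved`): the ¬line analogue of LEAD's `…SheetCauchyUniqueness`, WITHOUT coordinates.

Setting (class-free): `w : ℝ³ → ℝ` real-analytic (in the application `w = U₂(−1, · + τ⃗) − U₂(−1, ·)` for the translation period `τ⃗` of the limit branch) with
the slice law `∂₂²w = −μ(x₂)Δₕw` on the slab `{x₂ ∈ I}`; `Γ` a `C²` unit-speed planar branch with Frenet law `Γ″ = k•JΓ′`; `d` smooth on `I`; the parallel web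
`W(s,z) = Γ s + d z•JΓ′ s + z•e₂` with Fermi factor `1 − k(s)d(z) ≠ 0`; zero Cauchy data `w(W) = 0`, `Dw(W) = 0` on the region `ℝ × I`; and the sheet
NON-characteristic: `d′(z)² + μ(z) ≠ 0` on `I`.  Then every jet of `w` vanishes on the sheet:

* `iteratedFDeriv_eq_zero_on_sheet` — `Dᴺw(W(s,z)) = 0` for all `N`, all `s`, `z ∈ I`.  JET INDUCTION: if the `n`- and `(n+1)`-jets vanish on the sheet then
  (i) `Dⁿ⁺²w(W)[τ, …] = 0` for the sheet tangents `τ ∈ {(1 − kd)Γ′, d′JΓ′ + e₂}` (tangential derivative of a vanishing function; slot symmetry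
  `Literature…iteratedFDeriv_apply_perm_of_le`); (ii) the slice law restricted to the NORMAL LINE `m ↦ W + m•JΓ′` (along which `μ` is constant) and differentiated `n`
  times gives `(d′² + μ)·Dⁿ⁺²w(W)[JΓ′, …, JΓ′] = 0` after expanding `e₂ = (d′JΓ′ + e₂) − d′JΓ′`, `eᵢ = ⟪eᵢ,Γ′⟫Γ′ + ⟪eᵢ,JΓ′⟫JΓ′`; (iii) multilinear expansion
  in the frame `(Γ′, d′JΓ′ + e₂, JΓ′)` (`multilinear_eq_zero_of_slots`);
* ★ `eqOn_zero_nhds_of_sheet` — hence `w = 0` on a ball around every sheet point (Taylor expansion of an analytic function,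
  `HasFPowerSeriesOnBall.hasSum_iteratedFDeriv`).

Consumer (next file): the PERIODIC-curvature sub-case of (Q4-curved): translation period of the proper limit branch (`…PlanarCurveRigidity`,
`…Q4LimitBranchProper`) ⇒ a local horizontal period of `U₂(−1,·)` ⇒ port-2's `…HorizontalPeriod.false_of_local_horizontalPeriod_slab`.
WHAT THIS IS NOT: not a claim about Navier–Stokes regularity; class-free analysis (bears_on LADDER-NS N0 via item 20428; items 20428 / 19708 / 27893 OPEN).
-/

noncomputable section

-- the summit and its single sub-problem share the name (CONVENTIONS §1), as in every Theorems file
set_option linter.dupNamespace false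

namespace Summit.NavierStokesRegularity.NavierStokesRegularity.Theorems.PoloidalWindowDoorLrcModEntireCurvedSheetUniqueness

open Set Function Filter Topology
open scoped InnerProductSpace RealInnerProductSpace ContDiff
open Summit.NavierStokesRegularity.NavierStokesRegularity.Theorems.PoloidalWindowDoorLrcModEntireSheetFlattenTools
open Summit.NavierStokesRegularity.NavierStokesRegularity.Theorems.PoloidalWindowDoorLrcModEntireParallelWebsIdentity
open Summit.NavierStokesRegularity.NavierStokesRegularity.Theorems.PoloidalWindowDoorLrcModEntireRidgeGlobalBranchODE
open Summit.NavierStokesRegularity.NavierStokesRegularity.Theorems.PoloidalWindowDoorLrcModEntireRidgeGlobalBranchFrame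
open Summit.NavierStokesRegularity.NavierStokesRegularity.Theorems.PoloidalWindowDoorLrcModEntirePlanarCurveRigidity
open Summit.NavierStokesRegularity.NavierStokesRegularity.Theorems.PoloidalWindowDoorLrcModEntireCurvedWebHuygens

/-! ### A. Algebra: a multilinear form killed in every slot by two vectors and on the diagonal of a third -/

/-- A continuous multilinear form on `(ℝ³)ᴺ` which vanishes whenever one slot is `a` or `b`, and vanishes on `(c,…,c)`, is zero — provided every vector
is a combination of `a, b, c`. -/
theorem multilinear_eq_zero_of_slots {N : ℕ} (M : ContinuousMultilinearMap ℝ (fun _ : Fin N => EuclideanSpace ℝ (Fin 3)) ℝ)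
    {a b c : EuclideanSpace ℝ (Fin 3)}
    (ha : ∀ (v : Fin N → EuclideanSpace ℝ (Fin 3)) (i : Fin N), M (update v i a) = 0)
    (hb : ∀ (v : Fin N → EuclideanSpace ℝ (Fin 3)) (i : Fin N), M (update v i b) = 0)
    (hc : M (fun _ => c) = 0)
    (hdec : ∀ u : EuclideanSpace ℝ (Fin 3), ∃ α β γ : ℝ, u = α • a + β • b + γ • c) :
    ∀ v, M v = 0 := by
  -- `S k`: the claim for tuples whose slots `≥ k` are all `c`
  have hS : ∀ k : ℕ, ∀ v : Fin N → EuclideanSpace ℝ (Fin 3), (∀ i : Fin N, k ≤ i.val → v i = c) → M v = 0 := by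
    intro k
    induction k with
    | zero =>
      intro v hv
      have : v = fun _ => c := funext fun i => hv i (Nat.zero_le _)
      rw [this]; exact hc
    | succ k ih =>
      intro v hv
      by_cases hk : k < N
      · set i₀ : Fin N := ⟨k, hk⟩ with hi₀
        obtain ⟨α, β, γ, hu⟩ := hdec (v i₀)
        have hv' : v = update v i₀ (α • a + β • b + γ • c) := by rw [← hu, update_eq_self]
        rw [hv', M.map_update_add, M.map_update_add, M.map_update_smul, M.map_update_smul, M.map_update_smul, ha, hb]
        simp only [smul_zero, zero_add]
        have h' : M (update v i₀ c) = 0 := by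
          apply ih
          intro i hi
          by_cases hii : i = i₀
          · rw [hii, update_self]
          · rw [update_of_ne hii]
            apply hv
            have : i.val ≠ k := fun h => hii (Fin.ext (by rw [h]))
            omega
        rw [h', smul_zero]
      · apply ih
        intro i hi
        exfalso
        have := i.isLt
        omega
  intro v
  exact hS N v fun i hi => absurd i.isLt (not_lt.2 hi)

/-- Decomposition of any vector in the frame `(T, d′•JT + e₂, JT)` for a horizontal unit `T`. -/
theorem decomp_frame {T : EuclideanSpace ℝ (Fin 3)} (hT2 : T 2 = 0) (hT : ‖T‖ = 1) (d' : ℝ) (u : EuclideanSpace ℝ (Fin 3)) :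
    u = ⟪u, T⟫ • T + (u 2) • (d' • rotJ T + e2) + (⟪u, rotJ T⟫ - d' * u 2) • rotJ T := by
  have hab := sq_add_sq_of_horizontal_unit hT2 hT
  ext i
  fin_cases i
  · simp [inner_eq_sum3, rotJ, e2, hT2]
    linear_combination (-(u 0)) * hab
  · simp [inner_eq_sum3, rotJ, e2, hT2]
    linear_combination (-(u 1)) * hab
  · simp [inner_eq_sum3, rotJ, e2, hT2]

/-! ### B. Calculus: derivatives of jets, along the sheet and along the normal line -/

section calculus

variable {w : EuclideanSpace ℝ (Fin 3) → ℝ}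

/-- `∂_u (y ↦ Dⁿ⁺¹w(y)[v]) = Dⁿ⁺²w(x)[u :: v]`. -/
theorem fderiv_iteratedFDeriv_apply (hw : ContDiff ℝ ∞ w) (n : ℕ) (x u : EuclideanSpace ℝ (Fin 3)) (v : Fin (n + 1) → EuclideanSpace ℝ (Fin 3)) :
    fderiv ℝ (fun y => iteratedFDeriv ℝ (n + 1) w y v) x u = iteratedFDeriv ℝ (n + 2) w x (Fin.cons u v) := by
  have hd : DifferentiableAt ℝ (iteratedFDeriv ℝ (n + 1) w) x :=
    (hw.differentiable_iteratedFDeriv (m := n + 1) (by exact_mod_cast ENat.coe_lt_top _)) x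
  rw [fderiv_continuousMultilinear_apply_const_apply hd v u, iteratedFDeriv_succ_apply_left]
  simp

/-- The line lemma: `dⁿ/dmⁿ g(x + m•ν) |ₘ₌₀ = Dⁿg(x)[ν,…,ν]`. -/
theorem iteratedDeriv_line {g : EuclideanSpace ℝ (Fin 3) → ℝ} (hg : ContDiff ℝ ∞ g) (x ν : EuclideanSpace ℝ (Fin 3)) (n : ℕ) :
    iteratedDeriv n (fun m : ℝ => g (x + m • ν)) 0 = iteratedFDeriv ℝ n g x (fun _ => ν) := by
  set L : ℝ →L[ℝ] EuclideanSpace ℝ (Fin 3) := ContinuousLinearMap.smulRight (1 : ℝ →L[ℝ] ℝ) ν with hL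
  have hL1 : ∀ m : ℝ, L m = m • ν := fun m => by simp [hL]
  have hfun : (fun m : ℝ => g (x + m • ν)) = (fun y => g (x + y)) ∘ L := by
    funext m; simp [hL1]
  rw [iteratedDeriv_eq_iteratedFDeriv, hfun]
  have hgx : ContDiff ℝ ∞ (fun y => g (x + y)) := hg.comp (contDiff_const.add contDiff_id)
  rw [L.iteratedFDeriv_comp_right hgx 0 (i := n) (by exact_mod_cast le_top)]
  simp only [ContinuousMultilinearMap.compContinuousLinearMap_apply, hL1, one_smul]
  rw [iteratedFDeriv_comp_add_left]
  simp

/-- `Dⁿ (y ↦ D²w(y) m₂) (x) m₁ = Dⁿ⁺²w(x) (m₁ ++ m₂)`: the `n`-jet of the 2-jet evaluated at fixed vectors (`iteratedFDeriv_add_apply'`-style splitting,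
proved by `iteratedFDeriv_succ_apply_right` twice). -/
theorem iteratedFDeriv_hessian_apply (hw : ContDiff ℝ ∞ w) (n : ℕ) (x ν a b : EuclideanSpace ℝ (Fin 3)) :
    iteratedFDeriv ℝ n (fun y => fderiv ℝ (fderiv ℝ w) y a b) x (fun _ => ν) =
      iteratedFDeriv ℝ (n + 2) w x (Fin.snoc (Fin.snoc (fun _ : Fin n => ν) a) b) := by
  -- peel the last two slots
  rw [iteratedFDeriv_succ_apply_right, iteratedFDeriv_succ_apply_right]
  simp only [Fin.init_snoc, Fin.snoc_last]
  -- `y ↦ fderiv (fderiv w) y a b` as the evaluation of the CLM-valued map `y ↦ fderiv (fun y' => fderiv w y') y`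
  have h1 : ContDiff ℝ ∞ (fun y => fderiv ℝ w y) := hw.fderiv_right (m := ∞) (by simp)
  have h2 : ContDiff ℝ ∞ (fun y => fderiv ℝ (fun y' => fderiv ℝ w y') y) := h1.fderiv_right (m := ∞) (by simp)
  have e1 : (fun y => fderiv ℝ (fderiv ℝ w) y a b) = fun y => (fderiv ℝ (fun y' => fderiv ℝ w y') y a) b := rfl
  rw [e1]
  rw [iteratedFDeriv_clm_apply_const_apply (h2.clm_apply contDiff_const) (by exact_mod_cast le_top),
    iteratedFDeriv_clm_apply_const_apply h2 (by exact_mod_cast le_top)]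

end calculus

/-! ### C. The jet induction -/

section sheet

variable {w : EuclideanSpace ℝ (Fin 3) → ℝ} {I : Set ℝ} {μ d : ℝ → ℝ} {Γ : ℝ → EuclideanSpace ℝ (Fin 3)} {k : ℝ → ℝ}

/-- `Fin.snoc` of a constant tuple with the same constant is the constant tuple. -/
theorem snoc_const {n : ℕ} (c : EuclideanSpace ℝ (Fin 3)) : (Fin.snoc (fun _ : Fin n => c) c : Fin (n + 1) → EuclideanSpace ℝ (Fin 3)) = fun _ => c := by
  funext i
  refine Fin.lastCases ?_ (fun j => ?_) i
  · simp [Fin.snoc_last]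
  · simp [Fin.snoc_castSucc]

/-- ★ **ALL JETS OF `w` VANISH ON A NON-CHARACTERISTIC CURVED SHEET carrying zero Cauchy data.**  See the module docstring. -/
theorem iteratedFDeriv_eq_zero_on_sheet (hw : AnalyticOnNhd ℝ w univ) (hI : IsOpen I) (hd : ContDiffOn ℝ ∞ d I)
    (hΓ : ContDiff ℝ 2 Γ) (hpl : ∀ s, Γ s 2 = 0) (hun : ∀ s, ‖deriv Γ s‖ = 1)
    (hk : ∀ s, deriv (deriv Γ) s = k s • rotJ (deriv Γ s))
    (hJ : ∀ s : ℝ, ∀ z ∈ I, 1 - k s * d z ≠ 0)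
    (hlaw : ∀ x : EuclideanSpace ℝ (Fin 3), x 2 ∈ I →
      fderiv ℝ (fun y => fderiv ℝ w y (EuclideanSpace.single 2 (1 : ℝ))) x (EuclideanSpace.single 2 (1 : ℝ)) =
        -μ (x 2) * (fderiv ℝ (fun y => fderiv ℝ w y (EuclideanSpace.single 0 (1 : ℝ))) x (EuclideanSpace.single 0 (1 : ℝ)) +
          fderiv ℝ (fun y => fderiv ℝ w y (EuclideanSpace.single 1 (1 : ℝ))) x (EuclideanSpace.single 1 (1 : ℝ))))
    (h0 : ∀ s : ℝ, ∀ z ∈ I, w (Γ s + d z • rotJ (deriv Γ s) + z • e2) = 0)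
    (h1 : ∀ s : ℝ, ∀ z ∈ I, fderiv ℝ w (Γ s + d z • rotJ (deriv Γ s) + z • e2) = 0)
    (hQ : ∀ z ∈ I, deriv d z ^ 2 + μ z ≠ 0) :
    ∀ (N : ℕ) (s : ℝ), ∀ z ∈ I, ∀ v : Fin N → EuclideanSpace ℝ (Fin 3), iteratedFDeriv ℝ N w (Γ s + d z • rotJ (deriv Γ s) + z • e2) v = 0 := by
  have hwi : ContDiff ℝ ∞ w := hw.contDiff
  have hw2 : ContDiff ℝ 2 w := hw.contDiff
  -- the curved web map with `G q = d q.2`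
  set Gd : ℝ × ℝ → ℝ := fun q => d q.2 with hGd
  have hdd : ∀ z ∈ I, DifferentiableAt ℝ d z := fun z hz => (hd.contDiffAt (hI.mem_nhds hz)).differentiableAt (by simp)
  have hGdd : ∀ q ∈ region I, DifferentiableAt ℝ Gd q := fun q hq => (hdd q.2 hq).comp q differentiableAt_snd
  have hGd_fd : ∀ q ∈ region I, ∀ h : ℝ × ℝ, fderiv ℝ Gd q h = deriv d q.2 * h.2 := fun q hq h => by
    rw [hGd, show (fun q : ℝ × ℝ => d q.2) = d ∘ Prod.snd from rfl, fderiv_comp q (hdd q.2 hq) differentiableAt_snd]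
    simp [fderiv_snd, mul_comm]
  -- the claim for two consecutive orders, by induction
  suffices key : ∀ n : ℕ, (∀ (s : ℝ), ∀ z ∈ I, ∀ v : Fin n → EuclideanSpace ℝ (Fin 3),
      iteratedFDeriv ℝ n w (Γ s + d z • rotJ (deriv Γ s) + z • e2) v = 0) ∧
      (∀ (s : ℝ), ∀ z ∈ I, ∀ v : Fin (n + 1) → EuclideanSpace ℝ (Fin 3),
      iteratedFDeriv ℝ (n + 1) w (Γ s + d z • rotJ (deriv Γ s) + z • e2) v = 0) by
    intro N; exact (key N).1
  intro n
  induction n with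
  | zero =>
    refine ⟨fun s z hz v => ?_, fun s z hz v => ?_⟩
    · rw [iteratedFDeriv_zero_apply]; exact h0 s z hz
    · rw [iteratedFDeriv_one_apply, h1 s z hz]; rfl
  | succ n ih =>
    obtain ⟨ihn, ihn1⟩ := ih
    refine ⟨ihn1, fun s z hz v => ?_⟩
    -- ### the step: the `(n+2)`-jet at the sheet point `x = W(s,z)`
    set x : EuclideanSpace ℝ (Fin 3) := Γ s + d z • rotJ (deriv Γ s) + z • e2 with hx
    set T : EuclideanSpace ℝ (Fin 3) := deriv Γ s with hTdef
    set ν : EuclideanSpace ℝ (Fin 3) := rotJ (deriv Γ s) with hνdef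
    set M := iteratedFDeriv ℝ (n + 2) w x with hM
    set τz : EuclideanSpace ℝ (Fin 3) := deriv d z • ν + e2 with hτz
    have hT2 : T 2 = 0 := (deriv_horizontal hΓ hpl s).1
    have hTu : ‖T‖ = 1 := hun s
    have hν2 : ν 2 = 0 := (rotJ_facts hT2 hTu).1
    have hνu : ‖ν‖ = 1 := (rotJ_facts hT2 hTu).2.1
    have hp : ((s, z) : ℝ × ℝ) ∈ region I := hz
    have hxW : Γ (s, z).1 + Gd (s, z) • rotJ (deriv Γ (s, z).1) + (s, z).2 • e2 = x := by simp [hx, hGd, hνdef]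
    -- (i) tangential vanishing in slot 0
    have htan : ∀ (v' : Fin (n + 1) → EuclideanSpace ℝ (Fin 3)) (h : ℝ × ℝ),
        M (Fin.cons ((h.1 * (1 - k s * d z)) • T + (deriv d z * h.2) • ν + h.2 • e2) v') = 0 := by
      intro v' h
      have hzero : ∀ q ∈ region I, (fun q : ℝ × ℝ => iteratedFDeriv ℝ (n + 1) w (Γ q.1 + Gd q • rotJ (deriv Γ q.1) + q.2 • e2) v') q = 0 :=
        fun q hq => ihn1 q.1 q.2 hq v'
      have hh := fderiv_eq_zero_of_eqOn_region hI hzero hp h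
      have hg : DifferentiableAt ℝ (fun y => iteratedFDeriv ℝ (n + 1) w y v') (Γ (s, z).1 + Gd (s, z) • rotJ (deriv Γ (s, z).1) + (s, z).2 • e2) :=
        ((hwi.differentiable_iteratedFDeriv (m := n + 1) (by exact_mod_cast ENat.coe_lt_top _)) _).continuousMultilinear_apply_const v'
      rw [fderiv_comp_curvedWeb hΓ hpl hk (hGdd _ hp) hg, fderiv_iteratedFDeriv_apply hwi, hGd_fd _ hp, hxW] at hh
      simpa [hM, hTdef, hνdef] using hh
    have hconsT : ∀ v' : Fin (n + 1) → EuclideanSpace ℝ (Fin 3), M (Fin.cons T v') = 0 := by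
      intro v'
      have h := htan v' (1, 0)
      simp only [one_mul, mul_zero, zero_smul, add_zero] at h
      rw [M.cons_smul] at h
      rcases mul_eq_zero.1 (by rwa [smul_eq_mul] at h) with h' | h'
      · exact absurd h' (hJ s z hz)
      · exact h'
    have hconsZ : ∀ v' : Fin (n + 1) → EuclideanSpace ℝ (Fin 3), M (Fin.cons τz v') = 0 := by
      intro v'
      have h := htan v' (0, 1)
      simp only [zero_mul, zero_smul, zero_add, mul_one, one_smul] at h
      exact h
    -- (i') symmetry: the same in every slot
    have hperm : ∀ (u : Fin (n + 2) → EuclideanSpace ℝ (Fin 3)) (σ : Equiv.Perm (Fin (n + 2))), M (fun j => u (σ j)) = M u :=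
      fun u σ => Literature.Analysis.Calculus.iteratedFDeriv_apply_perm_of_le ((hw x (mem_univ x)).contDiffAt) le_top u σ
    have hslot : ∀ (a : EuclideanSpace ℝ (Fin 3)), (∀ v', M (Fin.cons a v') = 0) →
        ∀ (u : Fin (n + 2) → EuclideanSpace ℝ (Fin 3)) (i : Fin (n + 2)), M (update u i a) = 0 := by
      intro a hcons u i
      set u' := update u i a with hu'
      have h := hperm u' (Equiv.swap 0 i)
      rw [← h]
      have e : (fun j => u' ((Equiv.swap 0 i) j)) = Fin.cons a (Fin.tail fun j => u' ((Equiv.swap 0 i) j)) := by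
        rw [← Fin.cons_self_tail (fun j => u' ((Equiv.swap 0 i) j))]
        congr 1
        simp [hu']
      rw [e]
      exact hcons _
    have ha := hslot T hconsT
    have hb := hslot τz hconsZ
    -- (ii) the slice law along the normal line
    set c₀ : ℝ := M (fun _ => ν) with hc₀
    have hDD : ∀ (a b : EuclideanSpace ℝ (Fin 3)) (m : ℝ), fderiv ℝ (fun y => fderiv ℝ w y b) (x + m • ν) a = fderiv ℝ (fderiv ℝ w) (x + m • ν) a b :=
      fun a b m => nested_eq_fderiv_fderiv hw2 _ a b
    have hxm2 : ∀ m : ℝ, (x + m • ν) 2 = z := fun m => by simp [hx, hνdef, hpl, e2, rotJ]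
    have hline0 : ∀ m : ℝ, fderiv ℝ (fderiv ℝ w) (x + m • ν) e2 e2 =
        -μ z * (fderiv ℝ (fderiv ℝ w) (x + m • ν) e0 e0 + fderiv ℝ (fderiv ℝ w) (x + m • ν) e1 e1) := by
      intro m
      have h := hlaw (x + m • ν) (by rw [hxm2]; exact hz)
      rw [hDD, hDD, hDD, hxm2] at h
      exact h
    -- the three line functions and their `n`-th derivatives
    have hgu : ∀ u : EuclideanSpace ℝ (Fin 3), ContDiff ℝ ∞ (fun y => fderiv ℝ (fderiv ℝ w) y u u) := fun u =>
      ((hwi.fderiv_right (m := ∞) (by simp)).fderiv_right (m := ∞) (by simp)).clm_apply contDiff_const |>.clm_apply contDiff_const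
    have hφ : ∀ u : EuclideanSpace ℝ (Fin 3), ContDiff ℝ ∞ (fun m : ℝ => fderiv ℝ (fderiv ℝ w) (x + m • ν) u u) := fun u =>
      (hgu u).comp (contDiff_const.add (contDiff_id.smul contDiff_const))
    have hNu : ∀ u : EuclideanSpace ℝ (Fin 3), iteratedDeriv n (fun m : ℝ => fderiv ℝ (fderiv ℝ w) (x + m • ν) u u) 0 =
        M (Fin.snoc (Fin.snoc (fun _ : Fin n => ν) u) u) := by
      intro u
      rw [iteratedDeriv_line (hgu u), iteratedFDeriv_hessian_apply hwi]
    have hPDE : M (Fin.snoc (Fin.snoc (fun _ : Fin n => ν) e2) e2) =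
        -μ z * (M (Fin.snoc (Fin.snoc (fun _ : Fin n => ν) e0) e0) + M (Fin.snoc (Fin.snoc (fun _ : Fin n => ν) e1) e1)) := by
      have hfun : (fun m : ℝ => fderiv ℝ (fderiv ℝ w) (x + m • ν) e2 e2) =
          fun m => -μ z * (((fun m : ℝ => fderiv ℝ (fderiv ℝ w) (x + m • ν) e0 e0) + (fun m : ℝ => fderiv ℝ (fderiv ℝ w) (x + m • ν) e1 e1)) m) := by
        funext m; simp only [Pi.add_apply]; exact hline0 m
      rw [← hNu, ← hNu, ← hNu, hfun, iteratedDeriv_const_mul_field,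
        iteratedDeriv_add ((hφ e0).contDiffAt.of_le (by exact_mod_cast le_top)) ((hφ e1).contDiffAt.of_le (by exact_mod_cast le_top))]
    -- (ii') expansion of the last two slots
    set r : Fin n → EuclideanSpace ℝ (Fin 3) := fun _ => ν with hr
    have hlast_b : ∀ (q : Fin (n + 1) → EuclideanSpace ℝ (Fin 3)), M (Fin.snoc q τz) = 0 := by
      intro q
      have h := hb (Fin.snoc q τz) (Fin.last _)
      rwa [update_eq_self_iff.2 (Fin.snoc_last _ _).symm] at h
    have hlast_a : ∀ (q : Fin (n + 1) → EuclideanSpace ℝ (Fin 3)), M (Fin.snoc q T) = 0 := by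
      intro q
      have h := ha (Fin.snoc q T) (Fin.last _)
      rwa [update_eq_self_iff.2 (Fin.snoc_last _ _).symm] at h
    have hswap : ∀ a b : EuclideanSpace ℝ (Fin 3), M (Fin.snoc (Fin.snoc r a) b) = M (Fin.snoc (Fin.snoc r b) a) := by
      intro a b
      have h := hperm (Fin.snoc (Fin.snoc r a) b) (Equiv.swap (Fin.last (n + 1)) (Fin.castSucc (Fin.last n)))
      rw [← h]
      congr 1
      funext j
      by_cases hj1 : j = Fin.last (n + 1)
      · subst hj1
        simp [Equiv.swap_apply_left, Fin.snoc_last, Fin.snoc_castSucc]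
      · by_cases hj2 : j = Fin.castSucc (Fin.last n)
        · subst hj2
          simp [Equiv.swap_apply_right, Fin.snoc_last, Fin.snoc_castSucc]
        · rw [Equiv.swap_apply_of_ne_of_ne hj1 hj2]
          -- `j` is one of the first `n` slots: both sides are `ν`
          obtain ⟨j', rfl⟩ : ∃ j' : Fin (n + 1), j = Fin.castSucc j' := by
            rcases Fin.eq_castSucc_or_eq_last j with ⟨j', hj'⟩ | hj'
            · exact ⟨j', hj'⟩
            · exact absurd hj' hj1
          have hj3 : j' ≠ Fin.last n := fun h => hj2 (by rw [h])
          obtain ⟨j'', rfl⟩ : ∃ j'' : Fin n, j' = Fin.castSucc j'' := by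
            rcases Fin.eq_castSucc_or_eq_last j' with ⟨j'', hj''⟩ | hj''
            · exact ⟨j'', hj''⟩
            · exact absurd hj'' hj3
          simp [Fin.snoc_castSucc, hr]
    have hlin : ∀ (q : Fin (n + 1) → EuclideanSpace ℝ (Fin 3)) (a b : EuclideanSpace ℝ (Fin 3)) (α β : ℝ),
        M (Fin.snoc q (α • a + β • b)) = α * M (Fin.snoc q a) + β * M (Fin.snoc q b) := by
      intro q a b α β
      have e : ∀ u : EuclideanSpace ℝ (Fin 3), (Fin.snoc q u : Fin (n + 2) → EuclideanSpace ℝ (Fin 3)) =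
          update (Fin.snoc q (0 : EuclideanSpace ℝ (Fin 3))) (Fin.last (n + 1)) u := fun u => by
        rw [Fin.update_snoc_last]
      rw [e (α • a + β • b), e a, e b, M.map_update_add, M.map_update_smul, M.map_update_smul, smul_eq_mul, smul_eq_mul]
    -- `N(a, e₂) = −d′ N(a, ν)` and `N(a, eᵢ) = νᵢ N(a, ν)`
    have hNe2 : ∀ a, M (Fin.snoc (Fin.snoc r a) e2) = -deriv d z * M (Fin.snoc (Fin.snoc r a) ν) := by
      intro a
      have he : (e2 : EuclideanSpace ℝ (Fin 3)) = (1 : ℝ) • τz + (-deriv d z) • ν := by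
        simp only [hτz, one_smul]; module
      rw [he, hlin, hlast_b, mul_zero, zero_add]
    have hNei : ∀ (a e : EuclideanSpace ℝ (Fin 3)), e 2 = 0 → M (Fin.snoc (Fin.snoc r a) e) = ⟪e, ν⟫ * M (Fin.snoc (Fin.snoc r a) ν) := by
      intro a e he
      have hexp := horiz_expand he hT2 hTu
      rw [hexp, hlin, hlast_a, mul_zero, zero_add, ← hνdef]
      congr 1
      rw [← hexp]
    have hrνν : (Fin.snoc (Fin.snoc r ν) ν : Fin (n + 2) → EuclideanSpace ℝ (Fin 3)) = fun _ => ν := by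
      rw [hr, snoc_const, snoc_const]
    have hN22 : M (Fin.snoc (Fin.snoc r e2) e2) = deriv d z ^ 2 * c₀ := by
      rw [hNe2, hswap, hNe2, hrνν, hc₀]; ring
    have hNii : ∀ e : EuclideanSpace ℝ (Fin 3), e 2 = 0 → M (Fin.snoc (Fin.snoc r e) e) = ⟪e, ν⟫ ^ 2 * c₀ := by
      intro e he
      rw [hNei e e he, hswap, hNei ν e he, hrνν, hc₀]; ring
    have hsum : ⟪(e0 : EuclideanSpace ℝ (Fin 3)), ν⟫ ^ 2 + ⟪(e1 : EuclideanSpace ℝ (Fin 3)), ν⟫ ^ 2 = 1 := by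
      have h := sq_add_sq_of_horizontal_unit hν2 hνu
      rw [inner_eq_sum3, inner_eq_sum3]
      simp [e0, e1]
      linear_combination h
    have hc₀0 : c₀ = 0 := by
      have h := hPDE
      rw [hN22, hNii e0 (by simp [e0]), hNii e1 (by simp [e1])] at h
      have h2 : (deriv d z ^ 2 + μ z) * c₀ = 0 := by linear_combination h - μ z * c₀ * hsum
      rcases mul_eq_zero.1 h2 with h3 | h3
      · exact absurd h3 (hQ z hz)
      · exact h3
    -- (iii) multilinear expansion
    have hdec : ∀ u : EuclideanSpace ℝ (Fin 3), ∃ α β γ : ℝ, u = α • T + β • τz + γ • ν := fun u =>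
      ⟨⟪u, T⟫, u 2, ⟪u, rotJ T⟫ - deriv d z * u 2, by rw [hτz, hνdef, hTdef]; exact decomp_frame hT2 hTu (deriv d z) u⟩
    exact multilinear_eq_zero_of_slots M ha hb (by rw [← hc₀]; exact hc₀0) hdec v

/-- ★ **CK UNIQUENESS ACROSS A CURVED NON-CHARACTERISTIC SHEET**: under the hypotheses of `iteratedFDeriv_eq_zero_on_sheet`, `w` vanishes on a neighbourhood of
every sheet point (Taylor expansion of the analytic `w`). -/
theorem eqOn_zero_nhds_of_sheet (hw : AnalyticOnNhd ℝ w univ) (hI : IsOpen I) (hd : ContDiffOn ℝ ∞ d I)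
    (hΓ : ContDiff ℝ 2 Γ) (hpl : ∀ s, Γ s 2 = 0) (hun : ∀ s, ‖deriv Γ s‖ = 1)
    (hk : ∀ s, deriv (deriv Γ) s = k s • rotJ (deriv Γ s))
    (hJ : ∀ s : ℝ, ∀ z ∈ I, 1 - k s * d z ≠ 0)
    (hlaw : ∀ x : EuclideanSpace ℝ (Fin 3), x 2 ∈ I →
      fderiv ℝ (fun y => fderiv ℝ w y (EuclideanSpace.single 2 (1 : ℝ))) x (EuclideanSpace.single 2 (1 : ℝ)) =
        -μ (x 2) * (fderiv ℝ (fun y => fderiv ℝ w y (EuclideanSpace.single 0 (1 : ℝ))) x (EuclideanSpace.single 0 (1 : ℝ)) +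
          fderiv ℝ (fun y => fderiv ℝ w y (EuclideanSpace.single 1 (1 : ℝ))) x (EuclideanSpace.single 1 (1 : ℝ))))
    (h0 : ∀ s : ℝ, ∀ z ∈ I, w (Γ s + d z • rotJ (deriv Γ s) + z • e2) = 0)
    (h1 : ∀ s : ℝ, ∀ z ∈ I, fderiv ℝ w (Γ s + d z • rotJ (deriv Γ s) + z • e2) = 0)
    (hQ : ∀ z ∈ I, deriv d z ^ 2 + μ z ≠ 0) (s : ℝ) {z : ℝ} (hz : z ∈ I) :
    ∀ᶠ y in 𝓝 (Γ s + d z • rotJ (deriv Γ s) + z • e2), w y = 0 := by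
  set x := Γ s + d z • rotJ (deriv Γ s) + z • e2 with hx
  have hjet := iteratedFDeriv_eq_zero_on_sheet hw hI hd hΓ hpl hun hk hJ hlaw h0 h1 hQ
  obtain ⟨p, r, hp⟩ := hw x (mem_univ x)
  have hr : 0 < r := hp.r_pos
  have hball : ∀ y ∈ Metric.eball x r, w y = 0 := by
    intro y hy
    have hy' : y - x ∈ Metric.eball (0 : EuclideanSpace ℝ (Fin 3)) r := by
      rw [Metric.mem_eball, edist_eq_enorm_sub, sub_zero]; rw [Metric.mem_eball, edist_eq_enorm_sub] at hy; exact hy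
    have hsum := hp.hasSum_iteratedFDeriv hy'
    have hzero : (fun n => ((Nat.factorial n : ℝ))⁻¹ • iteratedFDeriv ℝ n w x fun _ => y - x) = fun _ => 0 := by
      funext n
      rw [hjet n s z hz, smul_zero]
    rw [hzero, add_sub_cancel] at hsum
    exact (hsum.unique hasSum_zero)
  exact Filter.eventually_of_mem (Metric.eball_mem_nhds x hr) hball

end sheet

end Summit.NavierStokesRegularity.NavierStokesRegularity.Theorems.PoloidalWindowDoorLrcModEntireCurvedSheetUniqueness
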